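import Mathlib
import HarnessLib

/-!
# Stub `stub_seedObstruction` of line `birth` — helper 1: pointwise algebra
(crux `HiddenChargeMazur.DressedCharge`, item stmt-AtomisticToContinuum-13509; `--supports` helper)

The seed obstruction: a would-be odd conserved density with seed `u₁ = Σ a_m q_m`,
`A(z) = Σ a_m z^m ≠ 0`, forces, after three plane-wave transforms (the third at zero
wavenumber), an identity `t · c = K · ΔA` on the admissible set
`μ₁² = -ω̃(z₁)`, `μ₂² = -ω̃(z₂)`, `μ₃² = -ω₂` (`ω̃(z) = ω₂ + 2 - z - z⁻¹`), with
`t = (μ₁+μ₂+μ₃)² + ω̃(z₁z₂)` and `c = c0 + μ₁μ₂ c12 + μ₁μ₃ c13 + μ₂μ₃ c23`.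

This file (pure algebra over `ℂ`, no chain):
* `seed_signProduct`: multiplying the identity over the four sign classes of `(μ₂, μ₃)`
  eliminates the square roots: `E₃ · 𝒢 = K⁴ ΔA⁴`, where `E₃ = ∏_δ t_δ` is the four-phonon
  resonance quartic (four-square identity) and `𝒢 = ∏_δ c_δ` is an explicit polynomial in
  `c0, c12, c13, c23, ω̃(z₁), ω̃(z₂), ω₂`;
* `seed_sum_eq_zero`: the trivial resonance `z₁ = z₂ = 1`, `μ₂ = -μ₃` gives `Σ a_m = 0`;
* `seed_reflect_laurent`, `seed_reflect_id`: the symmetry `(z₁, z₂, a) ↦ (z₁⁻¹, z₂⁻¹, a ∘ neg)`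
  of the hypotheses (used to reduce "`a` has a positive exponent" to "`a` has a negative one").

No new definitions: the quartic `E₃` and the product `𝒢` are written out in the statements.
-/

noncomputable section

namespace Summit.AtomisticToContinuum.FouriersLaw.Theorems.DressedCharge

/-- `ω̃(z⁻¹) = ω̃(z)` for `ω̃(z) = ω₂ + 2 - z - z⁻¹` (anchor of this helper file). -/
theorem seed_omt_inv :
    ∀ (ω₂ : ℝ) (z : ℂ), (ω₂ : ℂ) + 2 - z⁻¹ - z⁻¹⁻¹ = (ω₂ : ℂ) + 2 - z - z⁻¹ := by
  intro ω₂ z; rw [inv_inv]; ring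

/-- **Sign-class product.** From the seed identity `t · c = K · R` on the admissible set,
for `z₁, z₂ ≠ 0`: `E₃(ω̃(z₁z₂), ω̃ z₁, ω̃ z₂, ω₂) · 𝒢 = K⁴ R⁴`, where
`E₃(T,A,B,C) = (T²+A²+B²+C² - 2(TA+TB+TC+AB+AC+BC))² - 64·TABC = ∏_{±,±} (T + (m₁ ± m₂ ± m₃)²)`
for `m₁² = -A, m₂² = -B, m₃² = -C`, and `𝒢` is the product of `c0 ± μ₁μ₂c12 ± μ₁μ₃c13 ± μ₂μ₃c23`
over the sign classes, written with `(μ₁μ₂)² = AB`, `(μ₁μ₃)² = AC`, `(μ₂μ₃)² = BC`,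
`(μ₁μ₂)(μ₁μ₃)(μ₂μ₃) = -ABC`. The values `ω̃ z₁, ω̃ z₂, ω̃(z₁z₂)` enter through `hw₁ hw₂ hw₁₂`. -/
theorem seed_signProduct {ω₂ : ℝ} {K : ℂ} {c0 c12 c13 c23 R : ℂ → ℂ → ℂ}
    (hid : ∀ z₁ z₂ μ₁ μ₂ μ₃ : ℂ, z₁ ≠ 0 → z₂ ≠ 0 →
        μ₁ ^ 2 = -((ω₂ : ℂ) + 2 - (z₁) - (z₁)⁻¹) → μ₂ ^ 2 = -((ω₂ : ℂ) + 2 - (z₂) - (z₂)⁻¹) →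
        μ₃ ^ 2 = -(ω₂ : ℂ) →
        ((μ₁ + μ₂ + μ₃) ^ 2 + ((ω₂ : ℂ) + 2 - (z₁ * z₂) - (z₁ * z₂)⁻¹)) *
            (c0 z₁ z₂ + μ₁ * μ₂ * c12 z₁ z₂ + μ₁ * μ₃ * c13 z₁ z₂ + μ₂ * μ₃ * c23 z₁ z₂) =
          K * R z₁ z₂)
    {z₁ z₂ : ℂ} (hz₁ : z₁ ≠ 0) (hz₂ : z₂ ≠ 0) {w₁ w₂ w₁₂ : ℂ}
    (hw₁ : w₁ = ((ω₂ : ℂ) + 2 - (z₁) - (z₁)⁻¹)) (hw₂ : w₂ = ((ω₂ : ℂ) + 2 - (z₂) - (z₂)⁻¹))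
    (hw₁₂ : w₁₂ = (ω₂ : ℂ) + 2 - (z₁ * z₂) - (z₁ * z₂)⁻¹) :
    ((w₁₂ ^ 2 + w₁ ^ 2 + w₂ ^ 2 + (ω₂ : ℂ) ^ 2 - 2 * (w₁₂ * w₁ + w₁₂ * w₂ + w₁₂ * (ω₂ : ℂ) + w₁ * w₂
          + w₁ * (ω₂ : ℂ) + w₂ * (ω₂ : ℂ))) ^ 2 - 64 * w₁₂ * w₁ * w₂ * (ω₂ : ℂ)) *
      (c0 z₁ z₂ ^ 4 + (w₁ * w₂ * c12 z₁ z₂ ^ 2) ^ 2 + (w₁ * (ω₂ : ℂ) * c13 z₁ z₂ ^ 2) ^ 2 + (w₂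
            * (ω₂ : ℂ) * c23 z₁ z₂ ^ 2) ^ 2 - 2 * (c0 z₁ z₂ ^ 2 * (w₁ * w₂ * c12 z₁ z₂ ^ 2)
            + c0 z₁ z₂ ^ 2 * (w₁ * (ω₂ : ℂ) * c13 z₁ z₂ ^ 2) + c0 z₁ z₂ ^ 2 * (w₂ * (ω₂ : ℂ)
            * c23 z₁ z₂ ^ 2) + (w₁ * w₂ * c12 z₁ z₂ ^ 2) * (w₁ * (ω₂ : ℂ) * c13 z₁ z₂ ^ 2) + (w₁
            * w₂ * c12 z₁ z₂ ^ 2) * (w₂ * (ω₂ : ℂ) * c23 z₁ z₂ ^ 2) + (w₁ * (ω₂ : ℂ)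
            * c13 z₁ z₂ ^ 2) * (w₂ * (ω₂ : ℂ) * c23 z₁ z₂ ^ 2)) - 8 * c0 z₁ z₂ * (w₁ * w₂ * (ω₂ : ℂ)
            * (c12 z₁ z₂ * c13 z₁ z₂ * c23 z₁ z₂))) =
      K ^ 4 * R z₁ z₂ ^ 4 := by
  obtain ⟨m₁, hm₁⟩ := IsAlgClosed.exists_pow_nat_eq (-w₁) two_pos
  obtain ⟨m₂, hm₂⟩ := IsAlgClosed.exists_pow_nat_eq (-w₂) two_pos
  obtain ⟨m₃, hm₃⟩ := IsAlgClosed.exists_pow_nat_eq (-(ω₂ : ℂ)) two_pos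
  have h₁ : m₁ ^ 2 = -((ω₂ : ℂ) + 2 - (z₁) - (z₁)⁻¹) := by rw [hm₁, hw₁]
  have h₂ : ∀ δ : ℂ, δ ^ 2 = 1 → (δ * m₂) ^ 2 = -((ω₂ : ℂ) + 2 - (z₂) - (z₂)⁻¹) :=
    fun δ hδ => by rw [mul_pow, hδ, one_mul, hm₂, hw₂]
  have h₃ : ∀ δ : ℂ, δ ^ 2 = 1 → (δ * m₃) ^ 2 = -(ω₂ : ℂ) :=
    fun δ hδ => by rw [mul_pow, hδ, one_mul, hm₃]
  have hpp := hid z₁ z₂ m₁ (1 * m₂) (1 * m₃) hz₁ hz₂ h₁ (h₂ 1 (by norm_num)) (h₃ 1 (by norm_num))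
  have hpm := hid z₁ z₂ m₁ (1 * m₂) (-1 * m₃) hz₁ hz₂ h₁ (h₂ 1 (by norm_num))
    (h₃ (-1) (by norm_num))
  have hmp := hid z₁ z₂ m₁ (-1 * m₂) (1 * m₃) hz₁ hz₂ h₁ (h₂ (-1) (by norm_num))
    (h₃ 1 (by norm_num))
  have hmm := hid z₁ z₂ m₁ (-1 * m₂) (-1 * m₃) hz₁ hz₂ h₁ (h₂ (-1) (by norm_num))
    (h₃ (-1) (by norm_num))
  rw [← hw₁₂] at hpp hpm hmp hmm
  have prod := congrArg₂ HMul.hMul (congrArg₂ HMul.hMul (congrArg₂ HMul.hMul hpp hpm) hmp) hmm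
  have ew₁ : w₁ = (-m₁ ^ 2) := by rw [hm₁, neg_neg]
  have ew₂ : w₂ = (-m₂ ^ 2) := by rw [hm₂, neg_neg]
  subst ew₁ ew₂
  rw [show (ω₂ : ℂ) = (-m₃ ^ 2) by rw [hm₃, neg_neg]]
  generalize c0 z₁ z₂ = α, c12 z₁ z₂ = p, c13 z₁ z₂ = q, c23 z₁ z₂ = r, R z₁ z₂ = ρ at prod ⊢
  have ht : ((m₁ + 1 * m₂ + 1 * m₃) ^ 2 + w₁₂) * ((m₁ + 1 * m₂ + -1 * m₃) ^ 2 + w₁₂) * ((m₁ + -1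
        * m₂ + 1 * m₃) ^ 2 + w₁₂) * ((m₁ + -1 * m₂ + -1 * m₃) ^ 2 + w₁₂) =
      ((w₁₂ ^ 2 + (-m₁ ^ 2) ^ 2 + (-m₂ ^ 2) ^ 2 + (-m₃ ^ 2) ^ 2 - 2 * (w₁₂ * (-m₁ ^ 2) + w₁₂
            * (-m₂ ^ 2) + w₁₂ * (-m₃ ^ 2) + (-m₁ ^ 2) * (-m₂ ^ 2) + (-m₁ ^ 2) * (-m₃ ^ 2)
            + (-m₂ ^ 2) * (-m₃ ^ 2))) ^ 2 - 64 * w₁₂ * (-m₁ ^ 2) * (-m₂ ^ 2) * (-m₃ ^ 2)) := by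
    ring
  have hc : (α + m₁ * (1 * m₂) * p + m₁ * (1 * m₃) * q + 1 * m₂ * (1 * m₃) * r) * (α + m₁ * (1 * m₂)
        * p + m₁ * (-1 * m₃) * q + 1 * m₂ * (-1 * m₃) * r) * (α + m₁ * (-1 * m₂) * p + m₁ * (1 * m₃)
        * q + -1 * m₂ * (1 * m₃) * r) * (α + m₁ * (-1 * m₂) * p + m₁ * (-1 * m₃) * q + -1 * m₂ * (-1
        * m₃) * r) =
      (α ^ 4 + ((-m₁ ^ 2) * (-m₂ ^ 2) * p ^ 2) ^ 2 + ((-m₁ ^ 2) * (-m₃ ^ 2) * q ^ 2) ^ 2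
            + ((-m₂ ^ 2) * (-m₃ ^ 2) * r ^ 2) ^ 2 - 2 * (α ^ 2 * ((-m₁ ^ 2) * (-m₂ ^ 2) * p ^ 2)
            + α ^ 2 * ((-m₁ ^ 2) * (-m₃ ^ 2) * q ^ 2) + α ^ 2 * ((-m₂ ^ 2) * (-m₃ ^ 2) * r ^ 2)
            + ((-m₁ ^ 2) * (-m₂ ^ 2) * p ^ 2) * ((-m₁ ^ 2) * (-m₃ ^ 2) * q ^ 2) + ((-m₁ ^ 2)
            * (-m₂ ^ 2) * p ^ 2) * ((-m₂ ^ 2) * (-m₃ ^ 2) * r ^ 2) + ((-m₁ ^ 2) * (-m₃ ^ 2) * q ^ 2)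
            * ((-m₂ ^ 2) * (-m₃ ^ 2) * r ^ 2)) - 8 * α * ((-m₁ ^ 2) * (-m₂ ^ 2) * (-m₃ ^ 2) * (p * q
            * r))) := by
    ring
  rw [← ht, ← hc, show ((m₁ + 1 * m₂ + 1 * m₃) ^ 2 + w₁₂) * ((m₁ + 1 * m₂ + -1 * m₃) ^ 2 + w₁₂)
        * ((m₁ + -1 * m₂ + 1 * m₃) ^ 2 + w₁₂) * ((m₁ + -1 * m₂ + -1 * m₃) ^ 2 + w₁₂) *
      ((α + m₁ * (1 * m₂) * p + m₁ * (1 * m₃) * q + 1 * m₂ * (1 * m₃) * r) * (α + m₁ * (1 * m₂) * p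
            + m₁ * (-1 * m₃) * q + 1 * m₂ * (-1 * m₃) * r) * (α + m₁ * (-1 * m₂) * p + m₁ * (1 * m₃)
            * q + -1 * m₂ * (1 * m₃) * r) * (α + m₁ * (-1 * m₂) * p + m₁ * (-1 * m₃) * q + -1 * m₂
            * (-1 * m₃) * r)) =
      (((m₁ + 1 * m₂ + 1 * m₃) ^ 2 + w₁₂) * (α + m₁ * (1 * m₂) * p + m₁ * (1 * m₃) * q + 1 * m₂ * (1
            * m₃) * r)) * (((m₁ + 1 * m₂ + -1 * m₃) ^ 2 + w₁₂) * (α + m₁ * (1 * m₂) * p + m₁ * (-1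
            * m₃) * q + 1 * m₂ * (-1 * m₃) * r)) * (((m₁ + -1 * m₂ + 1 * m₃) ^ 2 + w₁₂) * (α + m₁
            * (-1 * m₂) * p + m₁ * (1 * m₃) * q + -1 * m₂ * (1 * m₃) * r)) * (((m₁ + -1 * m₂ + -1
            * m₃) ^ 2 + w₁₂) * (α + m₁ * (-1 * m₂) * p + m₁ * (-1 * m₃) * q + -1 * m₂ * (-1 * m₃)
            * r)) from by ac_rfl, prod]
  ring

/-- **Trivial resonance.** At `z₁ = z₂ = 1`, `μ₂ = -μ₃` the multiplier `t` vanishes, so the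
seed identity forces `Σ_m a_m = 0` (as `K ≠ 0`). -/
theorem seed_sum_eq_zero {ω₂ : ℝ} {K : ℂ} (hK : K ≠ 0) {c0 c12 c13 c23 : ℂ → ℂ → ℂ} {a : ℤ →₀ ℂ}
    (hid : ∀ z₁ z₂ μ₁ μ₂ μ₃ : ℂ, z₁ ≠ 0 → z₂ ≠ 0 →
        μ₁ ^ 2 = -((ω₂ : ℂ) + 2 - (z₁) - (z₁)⁻¹) → μ₂ ^ 2 = -((ω₂ : ℂ) + 2 - (z₂) - (z₂)⁻¹) →
        μ₃ ^ 2 = -(ω₂ : ℂ) →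
        ((μ₁ + μ₂ + μ₃) ^ 2 + ((ω₂ : ℂ) + 2 - (z₁ * z₂) - (z₁ * z₂)⁻¹)) *
            (c0 z₁ z₂ + μ₁ * μ₂ * c12 z₁ z₂ + μ₁ * μ₃ * c13 z₁ z₂ + μ₂ * μ₃ * c23 z₁ z₂) =
          K * (a.sum (fun m c => c * ((z₁) * (z₂)) ^ m) - a.sum (fun m c => c * (z₁) ^ m)
                - a.sum (fun m c => c * (z₂) ^ m) - a.sum (fun m c => c * ((1 : ℂ)) ^ m))) :
    a.sum (fun _ c => c) = 0 := by
  obtain ⟨μ, hμ⟩ := IsAlgClosed.exists_pow_nat_eq (-(ω₂ : ℂ)) two_pos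
  have hμ' : μ ^ 2 = -((ω₂ : ℂ) + 2 - (1 : ℂ) - (1 : ℂ)⁻¹) := by rw [hμ, inv_one]; ring
  have h := hid 1 1 μ (-μ) μ one_ne_zero one_ne_zero hμ' (by rw [neg_sq]; exact hμ') hμ
  have ht : (μ + -μ + μ) ^ 2 + ((ω₂ : ℂ) + 2 - (1 * 1 : ℂ) - (1 * 1 : ℂ)⁻¹) = 0 := by
    rw [mul_one, inv_one]; linear_combination hμ
  rw [ht, zero_mul] at h
  simp only [mul_one, one_zpow] at h
  have h2 : (-2 * K) * a.sum (fun _ c => c) = 0 := by linear_combination -h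
  rcases mul_eq_zero.mp h2 with h3 | h3
  · exact absurd h3 (mul_ne_zero (by norm_num) hK)
  · exact h3

/-- Inversion of the variables of a bivariate polynomial, cleared of denominators:
`(z₁z₂)^d · p(z₁⁻¹, z₂⁻¹) = p'(z₁, z₂)` on `z₁ z₂ ≠ 0`. -/
theorem seed_reflect_eval (p : MvPolynomial (Fin 2) ℂ) :
    ∃ (d : ℕ) (p' : MvPolynomial (Fin 2) ℂ), ∀ z₁ z₂ : ℂ, z₁ ≠ 0 → z₂ ≠ 0 →
      (z₁ * z₂) ^ d * MvPolynomial.eval ![z₁⁻¹, z₂⁻¹] p = MvPolynomial.eval ![z₁, z₂] p' := by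
  induction p using MvPolynomial.induction_on with
  | C c => exact ⟨0, MvPolynomial.C c, fun z₁ z₂ _ _ => by simp⟩
  | add p q hp hq =>
    obtain ⟨d, p', hp'⟩ := hp
    obtain ⟨e, q', hq'⟩ := hq
    refine ⟨d + e, (MvPolynomial.X 0 * MvPolynomial.X 1) ^ e * p' +
      (MvPolynomial.X 0 * MvPolynomial.X 1) ^ d * q', fun z₁ z₂ h₁ h₂ => ?_⟩
    simp only [map_add, map_mul, map_pow, MvPolynomial.eval_X, Matrix.cons_val_zero,
      Matrix.cons_val_one, Matrix.cons_val_fin_one, ← hp' z₁ z₂ h₁ h₂, ← hq' z₁ z₂ h₁ h₂]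
    ring
  | mul_X p i hp =>
    obtain ⟨d, p', hp'⟩ := hp
    fin_cases i
    · refine ⟨d + 1, p' * MvPolynomial.X 1, fun z₁ z₂ h₁ h₂ => ?_⟩
      simp only [map_mul, MvPolynomial.eval_X, Fin.zero_eta, Fin.isValue, Matrix.cons_val_zero,
        Matrix.cons_val_one, Matrix.cons_val_fin_one, ← hp' z₁ z₂ h₁ h₂]
      field_simp
      ring
    · refine ⟨d + 1, p' * MvPolynomial.X 0, fun z₁ z₂ h₁ h₂ => ?_⟩
      simp only [map_mul, MvPolynomial.eval_X, Fin.mk_one, Fin.isValue, Matrix.cons_val_zero,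
        Matrix.cons_val_one, Matrix.cons_val_fin_one, ← hp' z₁ z₂ h₁ h₂]
      field_simp
      ring

/-- Reflected Laurent functions are Laurent: if `f · (z₁z₂)^N` is a polynomial on `(ℂˣ)²`,
so is `(z₁, z₂) ↦ f(z₁⁻¹, z₂⁻¹)` (with another exponent and polynomial). -/
theorem seed_reflect_laurent {f : ℂ → ℂ → ℂ}
    (hf : ∃ (N : ℕ) (p : MvPolynomial (Fin 2) ℂ), ∀ z₁ z₂ : ℂ, z₁ ≠ 0 → z₂ ≠ 0 →
        f z₁ z₂ * (z₁ * z₂) ^ N = MvPolynomial.eval ![z₁, z₂] p) :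
    ∃ (N : ℕ) (p : MvPolynomial (Fin 2) ℂ), ∀ z₁ z₂ : ℂ, z₁ ≠ 0 → z₂ ≠ 0 →
        f z₁⁻¹ z₂⁻¹ * (z₁ * z₂) ^ N = MvPolynomial.eval ![z₁, z₂] p := by
  obtain ⟨N, p, hp⟩ := hf
  obtain ⟨d, p', hp'⟩ := seed_reflect_eval p
  refine ⟨d, (MvPolynomial.X 0 * MvPolynomial.X 1) ^ N * p', fun z₁ z₂ h₁ h₂ => ?_⟩
  have h := hp z₁⁻¹ z₂⁻¹ (inv_ne_zero h₁) (inv_ne_zero h₂)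
  simp only [map_mul, map_pow, MvPolynomial.eval_X, Matrix.cons_val_zero, Matrix.cons_val_one,
    Matrix.cons_val_fin_one, ← hp' z₁ z₂ h₁ h₂, ← h]
  have hu : (z₁ * z₂) ^ N * (z₁⁻¹ * z₂⁻¹) ^ N = 1 := by
    rw [← mul_pow, show z₁ * z₂ * (z₁⁻¹ * z₂⁻¹) = 1 by field_simp, one_pow]
  linear_combination (-(f z₁⁻¹ z₂⁻¹ * (z₁ * z₂) ^ d)) * hu

/-- The seed identity is invariant under `(z₁, z₂, a) ↦ (z₁⁻¹, z₂⁻¹, a ∘ neg)` (with the `c`'s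
reflected), because `ω̃(z⁻¹) = ω̃(z)`. -/
theorem seed_reflect_id {ω₂ : ℝ} {K : ℂ} {c0 c12 c13 c23 : ℂ → ℂ → ℂ} {a : ℤ →₀ ℂ}
    (hid : ∀ z₁ z₂ μ₁ μ₂ μ₃ : ℂ, z₁ ≠ 0 → z₂ ≠ 0 →
        μ₁ ^ 2 = -((ω₂ : ℂ) + 2 - (z₁) - (z₁)⁻¹) → μ₂ ^ 2 = -((ω₂ : ℂ) + 2 - (z₂) - (z₂)⁻¹) →
        μ₃ ^ 2 = -(ω₂ : ℂ) →
        ((μ₁ + μ₂ + μ₃) ^ 2 + ((ω₂ : ℂ) + 2 - (z₁ * z₂) - (z₁ * z₂)⁻¹)) *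
            (c0 z₁ z₂ + μ₁ * μ₂ * c12 z₁ z₂ + μ₁ * μ₃ * c13 z₁ z₂ + μ₂ * μ₃ * c23 z₁ z₂) =
          K * (a.sum (fun m c => c * ((z₁) * (z₂)) ^ m) - a.sum (fun m c => c * (z₁) ^ m)
                - a.sum (fun m c => c * (z₂) ^ m) - a.sum (fun m c => c * ((1 : ℂ)) ^ m))) :
    ∀ z₁ z₂ μ₁ μ₂ μ₃ : ℂ, z₁ ≠ 0 → z₂ ≠ 0 →
        μ₁ ^ 2 = -((ω₂ : ℂ) + 2 - (z₁) - (z₁)⁻¹) → μ₂ ^ 2 = -((ω₂ : ℂ) + 2 - (z₂) - (z₂)⁻¹) →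
        μ₃ ^ 2 = -(ω₂ : ℂ) →
        ((μ₁ + μ₂ + μ₃) ^ 2 + ((ω₂ : ℂ) + 2 - (z₁ * z₂) - (z₁ * z₂)⁻¹)) *
            (c0 z₁⁻¹ z₂⁻¹ + μ₁ * μ₂ * c12 z₁⁻¹ z₂⁻¹ + μ₁ * μ₃ * c13 z₁⁻¹ z₂⁻¹ + μ₂ * μ₃
                  * c23 z₁⁻¹ z₂⁻¹) =
          K * ((Finsupp.equivMapDomain (Equiv.neg ℤ) a).sum (fun m c => c * ((z₁) * (z₂)) ^ m)
                - (Finsupp.equivMapDomain (Equiv.neg ℤ) a).sum (fun m c => c * (z₁) ^ m)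
                - (Finsupp.equivMapDomain (Equiv.neg ℤ) a).sum (fun m c => c * (z₂) ^ m)
                - (Finsupp.equivMapDomain (Equiv.neg ℤ) a).sum (fun m c => c * ((1 : ℂ)) ^ m)) := by
  intro z₁ z₂ μ₁ μ₂ μ₃ h₁ h₂ hμ₁ hμ₂ hμ₃
  have h := hid z₁⁻¹ z₂⁻¹ μ₁ μ₂ μ₃ (inv_ne_zero h₁) (inv_ne_zero h₂)
    (by rw [hμ₁, seed_omt_inv]) (by rw [hμ₂, seed_omt_inv]) hμ₃
  rw [← mul_inv, seed_omt_inv] at h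
  rw [h]
  congr 1
  simp only [Finsupp.sum_equivMapDomain, Equiv.neg_apply, zpow_neg, inv_zpow, one_zpow]

end Summit.AtomisticToContinuum.FouriersLaw.Theorems.DressedCharge
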